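import Mathlib.NumberTheory.Zsqrtd.QuadraticReciprocity
import Mathlib.RingTheory.DedekindDomain.AdicValuation
import Mathlib.RingTheory.Localization.FractionRing
import Mathlib.Algebra.CharP.Algebra
import Mathlib.RingTheory.PrincipalIdealDomain
import Literature.AnabelianGeometry.EtaleTheta.LogDivisorModelTateTowerArithmeticRat

/-!
# [EtTh] Def. 3.1 / Def. 3.3 / §3 p.72: the arithmetic Tate tower over `ℚ(i)/ℚ` at the inert prime `3` —
# an inhabitant of the parameter record with NON-trivial constant-field Galois group `Aut(L/K)`

S. Mochizuki, *The étale theta function …*, Publ. RIMS **45** (2009) [MochizukiEtTh2009], §3: Def. 3.1 / Prop. 3.2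
(PRIMS PDF p.70), Def. 3.3 (ii)–(iii) (p.73), the constant-field functor `D₀ → D^cnst` (p.72)
[cite: MochizukiEtTh2009, Def 3.3 p.73].  abc-iut cell, seat abc-iut-w5-d223 gen 6, row «TATE-TOWER-ARITH
NONTRIVIAL-AUT DATUM» (open successor row (c) of the abc-iut-w6-d058 lineage; L2-lead ROWS #75 R632).  Sequel to
`LogDivisorModelTateTowerArithmetic(Rat).lean`, whose inhabitant `Datum.rat p : Datum ℚ ℚ` has TRIVIAL
`Aut(L/K)` ("an inhabitant with non-trivial constant-field Galois group needs a number field with a Galois-invariant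
discrete valuation (e.g. an inert prime), not built here").  THIS FILE builds it:
* `GaussianRat := FractionRing GaussianInt` (`ℚ(i)`), `gi` (`= i`), `conj` (complex conjugation = the extension of
  `star` on `ℤ[i]`), **`algEquiv_eq_one_or_eq_conj : Aut(ℚ(i)/ℚ) = {1, conj}`**, `conj_ne_one`;
* `threeSpec` — the height-one prime `(3) ⊆ ℤ[i]` (`3 ≡ 3 mod 4` is INERT); `val3` — the `3`-adic valuation of
  `ℚ(i)` (Mathlib `IsDedekindDomain.HeightOneSpectrum.valuation`); `val3_three : v(3) = exp(−1)` (the RATIONAL prime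
  `3` is a uniformizer); **`val3_algEquiv`** — `v` is invariant under EVERY `σ ∈ Aut(ℚ(i)/ℚ)` (`star` preserves
  membership in each `(3)ⁿ`; extend to fractions; `σ ∈ {1, conj}`);
* **`units_eq_one_of_forall_exists_pow_eq`** — Prop. 3.2 (iii) for `ℚ(i)^×`: an infinitely divisible unit has all
  adic valuations `1`, so is a unit of `ℤ[i]`, a fourth root of unity (`Zsqrtd.norm_eq_one_iff'`), and a 4th power;
* **`TateTowerArith.Datum.gaussian : Datum ℚ GaussianRat`** (`q = 3`), `gaussian_aut_nontrivial` (`∃ σ ≠ 1`),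
  `constGaloisLaw_gaussian` (the [EtTh] Thm 3.7 (iii) Galois-correspondence binder is a THEOREM at a datum with
  non-trivial `Aut(L/K)`), `gaussian_constQuot_mk_ne` / `gaussian_conj_not_mem_constInertia` (the constant-field
  functor `D₀ → D^cnst` SEES `conj`).
CLASS (b) MODEL / NON-VACUITY file over Mathlib (`FractionRing`, `Zsqrtd`, adic valuations): no new Prop-valued fact,
no `instance`, no notation.  HONEST FRAMING: an arithmetic consistency witness for the typed [EtTh] §3 interfaces
(NOT the formal-scheme tower of a Tate curve); nothing of [EtTh] asserted; nothing here bears on [IUTchIII] Cor. 3.12;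
no side taken; typed ≠ proved.
-/

noncomputable section

namespace Literature.AnabelianGeometry.EtaleTheta

open IsDedekindDomain

/-- `ℚ(i)`, realised as the fraction field of the Gaussian integers `ℤ[i]` (the constant field `L` of the datum).
[cite: MochizukiEtTh2009, Def 3.1 p.70] -/
abbrev GaussianRat : Type := FractionRing GaussianInt

namespace GaussianRat

/-- `i ∈ ℚ(i)`. [folklore] -/
def gi : GaussianRat := algebraMap GaussianInt GaussianRat Zsqrtd.sqrtd

/-- `i² = −1` in `ℚ(i)`. [cite: MochizukiEtTh2009, Def 3.1 p.70] -/
theorem gi_sq : gi * gi = -1 := by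
  unfold gi
  rw [← map_mul, show (Zsqrtd.sqrtd * Zsqrtd.sqrtd : GaussianInt) = -1 from by ext <;> simp, map_neg, map_one]

/-- `i ≠ 0` in `ℚ(i)`. [folklore] -/
private theorem gi_ne_zero : gi ≠ 0 := by
  intro h
  have h1 : (Zsqrtd.sqrtd : GaussianInt) = 0 :=
    (IsFractionRing.injective GaussianInt GaussianRat) (by rw [map_zero]; exact h)
  have := congrArg Zsqrtd.im h1
  simp at this

/-- `x + yi ∈ ℤ[i]` maps to `x + i·y ∈ ℚ(i)`. [folklore] -/
private theorem algebraMap_mk (x y : ℤ) :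
    algebraMap GaussianInt GaussianRat ⟨x, y⟩ = (x : GaussianRat) + gi * (y : GaussianRat) := by
  rw [Zsqrtd.decompose, map_add, map_mul, map_intCast, map_intCast]
  rfl

/-- `3` is inert in `ℤ[i]` (`3 ≡ 3 mod 4`). [cite: MochizukiEtTh2009, Def 3.1 p.70] -/
theorem prime_three : Prime (3 : GaussianInt) := by
  have h := GaussianInt.prime_of_nat_prime_of_mod_four_eq_three 3 (by norm_num)
  simpa using h

/-- The height-one prime `(3)` of `ℤ[i]`. [cite: MochizukiEtTh2009, Def 3.1 p.70] -/
def threeSpec : HeightOneSpectrum GaussianInt where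
  asIdeal := Ideal.span {3}
  isPrime := (Ideal.span_singleton_prime prime_three.ne_zero).mpr prime_three
  ne_bot := by
    rw [Ne, Ideal.span_singleton_eq_bot]
    exact prime_three.ne_zero

/-- The `3`-adic valuation of `ℚ(i)` (the valuation `v` of the datum). [cite: MochizukiEtTh2009, Def 3.1 p.70] -/
def val3 : Valuation GaussianRat (WithZero (Multiplicative ℤ)) := threeSpec.valuation GaussianRat

/-- **The rational prime `3` is a uniformizer of the `3`-adic valuation of `ℚ(i)`**: `v(3) = exp(−1)`
(`3 ∈ (3) ∖ (3)²`, the latter by taking norms: `81 ∤ 9`). [cite: MochizukiEtTh2009, Def 3.1 p.70] -/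
theorem val3_three : val3 (3 : GaussianRat) = WithZero.exp (-1) := by
  have h3 : (3 : GaussianRat) = algebraMap GaussianInt GaussianRat 3 :=
    (map_ofNat (algebraMap GaussianInt GaussianRat) 3).symm
  rw [val3, h3, HeightOneSpectrum.valuation_of_algebraMap]
  have hne : (3 : GaussianInt) ≠ 0 := prime_three.ne_zero
  obtain ⟨c, hc⟩ : ∃ c : ℕ, threeSpec.intValuation (3 : GaussianInt) = WithZero.exp (-(c : ℤ)) :=
    ⟨_, threeSpec.intValuation_if_neg hne⟩
  have h1 : threeSpec.intValuation (3 : GaussianInt) ≤ WithZero.exp (-((1 : ℕ) : ℤ)) := by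
    rw [HeightOneSpectrum.intValuation_le_pow_iff_mem, pow_one]
    exact Ideal.mem_span_singleton_self 3
  have h2 : ¬ threeSpec.intValuation (3 : GaussianInt) ≤ WithZero.exp (-((2 : ℕ) : ℤ)) := by
    rw [HeightOneSpectrum.intValuation_le_pow_iff_mem]
    change (3 : GaussianInt) ∉ Ideal.span {3} ^ 2
    rw [Ideal.span_singleton_pow, Ideal.mem_span_singleton]
    rintro ⟨x, hx⟩
    have hn := congrArg Zsqrtd.norm hx
    rw [Zsqrtd.norm_mul] at hn
    rw [show ((3 : GaussianInt) ^ 2).norm = 81 from by norm_num [Zsqrtd.norm_def],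
      show (3 : GaussianInt).norm = 9 from by norm_num [Zsqrtd.norm_def]] at hn
    omega
  rw [hc] at h1 h2 ⊢
  rw [WithZero.exp_le_exp] at h1 h2
  push_cast at h1 h2
  have : (c : ℤ) = 1 := by omega
  rw [this]

/-- Complex conjugation on `ℚ(i)` (the extension of `star` on `ℤ[i]`). [cite: MochizukiEtTh2009, Def 3.3 p.73] -/
def conjRingEquiv : GaussianRat ≃+* GaussianRat :=
  IsFractionRing.ringEquivOfRingEquiv (starRingAut : GaussianInt ≃+* GaussianInt)

/-- Complex conjugation on `ℚ(i)` as a `ℚ`-algebra automorphism (an element of `Aut(L/K)`).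
[cite: MochizukiEtTh2009, Def 3.3 p.73] -/
def conj : GaussianRat ≃ₐ[ℚ] GaussianRat :=
  AlgEquiv.ofRingEquiv (f := conjRingEquiv) (fun q => by simp)

/-- `conj` extends `star`. [cite: MochizukiEtTh2009, Def 3.3 p.73] -/
theorem conj_algebraMap (z : GaussianInt) :
    conj (algebraMap GaussianInt GaussianRat z) = algebraMap GaussianInt GaussianRat (star z) := by
  change conjRingEquiv (algebraMap GaussianInt GaussianRat z) = _
  rw [conjRingEquiv, IsFractionRing.ringEquivOfRingEquiv_algebraMap]
  rfl

/-- `conj i = −i`. [cite: MochizukiEtTh2009, Def 3.3 p.73] -/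
theorem conj_gi : conj gi = -gi := by
  rw [gi, conj_algebraMap]
  rw [show star (Zsqrtd.sqrtd : GaussianInt) = -Zsqrtd.sqrtd from by ext <;> simp [Zsqrtd.sqrtd], map_neg]

/-- **`conj` is a NON-trivial element of `Aut(L/K) = Aut(ℚ(i)/ℚ)`.** [cite: MochizukiEtTh2009, Def 3.3 p.73] -/
theorem conj_ne_one : conj ≠ 1 := by
  intro h
  have h1 : conj gi = gi := by rw [h]; rfl
  rw [conj_gi, neg_eq_iff_add_eq_zero, ← two_mul, mul_eq_zero] at h1
  rcases h1 with h1 | h1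
  · norm_num at h1
  · exact gi_ne_zero h1

/-- `ℚ(i)` is spanned over `ℚ` by `1, i` (`x/y = x·ȳ/N(y)`). [folklore] -/
private theorem span_one_gi : Submodule.span ℚ ({1, gi} : Set GaussianRat) = ⊤ := by
  rw [eq_top_iff]
  rintro z -
  obtain ⟨x, y, hy, rfl⟩ := IsFractionRing.div_surjective (A := GaussianInt) z
  have hy0 : y ≠ 0 := nonZeroDivisors.ne_zero hy
  have hn0 : (y.norm : GaussianRat) ≠ 0 := by
    have : y.norm ≠ 0 := fun h => hy0 (GaussianInt.norm_eq_zero.mp h)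
    exact_mod_cast this
  -- x / y = x * star y / norm y
  have hyy : algebraMap GaussianInt GaussianRat y * algebraMap GaussianInt GaussianRat (star y) =
      (y.norm : GaussianRat) := by
    rw [← map_mul, ← Zsqrtd.norm_eq_mul_conj, map_intCast]
  have hy' : algebraMap GaussianInt GaussianRat y ≠ 0 :=
    (map_ne_zero_iff _ (IsFractionRing.injective GaussianInt GaussianRat)).mpr hy0
  have hxy : algebraMap GaussianInt GaussianRat x / algebraMap GaussianInt GaussianRat y =
      algebraMap GaussianInt GaussianRat (x * star y) / (y.norm : GaussianRat) := by
    rw [div_eq_div_iff hy' hn0, ← hyy, map_mul]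
    ring
  rw [hxy]
  set w := x * star y with hw
  rw [show w = ⟨w.re, w.im⟩ from rfl, algebraMap_mk, add_div, mul_div_assoc]
  refine Submodule.add_mem _ ?_ ?_
  · have : ((w.re : GaussianRat) / (y.norm : GaussianRat)) =
        ((w.re : ℚ) / (y.norm : ℚ)) • (1 : GaussianRat) := by
      rw [Algebra.smul_def, mul_one, map_div₀, map_intCast, map_intCast]
    rw [this]
    exact Submodule.smul_mem _ _ (Submodule.subset_span (by simp))
  · have : gi * ((w.im : GaussianRat) / (y.norm : GaussianRat)) = ((w.im : ℚ) / (y.norm : ℚ)) • gi := by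
      rw [Algebra.smul_def, map_div₀, map_intCast, map_intCast, mul_comm]
    rw [this]
    exact Submodule.smul_mem _ _ (Submodule.subset_span (by simp))

/-- `L/K = ℚ(i)/ℚ` is finite. [cite: MochizukiEtTh2009, Def 3.1 p.70] -/
theorem finiteDimensional : FiniteDimensional ℚ GaussianRat :=
  Module.finite_def.mpr ⟨{1, gi}, by simpa using span_one_gi⟩

/-- A `ℚ`-algebra automorphism of `ℚ(i)` sends `i` to `± i`. [folklore] -/
private theorem algEquiv_gi (σ : GaussianRat ≃ₐ[ℚ] GaussianRat) : σ gi = gi ∨ σ gi = -gi := by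
  have h : σ gi ^ 2 = gi ^ 2 := by
    rw [sq, sq, ← map_mul, gi_sq, map_neg, map_one]
  exact sq_eq_sq_iff_eq_or_eq_neg.mp h

/-- **`Aut(L/K) = Aut(ℚ(i)/ℚ) = {1, conj}`** (a ring endomorphism of `Frac ℤ[i]` is fixed by the image of `i`).
[cite: MochizukiEtTh2009, Def 3.3 p.73] -/
theorem algEquiv_eq_one_or_eq_conj (σ : GaussianRat ≃ₐ[ℚ] GaussianRat) : σ = 1 ∨ σ = conj := by
  -- a ring endomorphism of `ℚ(i)` is determined by its restriction to `ℤ[i]`, i.e. by the image of `i`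
  have key : ∀ τ : GaussianRat ≃ₐ[ℚ] GaussianRat, σ gi = τ gi → σ = τ := by
    intro τ hστ
    have hR : (σ : GaussianRat →+* GaussianRat).comp (algebraMap GaussianInt GaussianRat) =
        (τ : GaussianRat →+* GaussianRat).comp (algebraMap GaussianInt GaussianRat) :=
      Zsqrtd.hom_ext _ _ hστ
    have hL : (σ : GaussianRat →+* GaussianRat) = (τ : GaussianRat →+* GaussianRat) :=
      IsLocalization.ringHom_ext (nonZeroDivisors GaussianInt) hR
    exact AlgEquiv.ext fun z => RingHom.congr_fun hL z
  rcases algEquiv_gi σ with h | h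
  · exact Or.inl (key 1 (by rw [h]; rfl))
  · exact Or.inr (key conj (by rw [h, conj_gi]))

/-- `star` preserves membership in the powers of `(3) ⊆ ℤ[i]` (`3` is real). [folklore] -/
private theorem star_mem_span_three_pow_iff (a : GaussianInt) (n : ℕ) :
    star a ∈ (Ideal.span {(3 : GaussianInt)}) ^ n ↔ a ∈ (Ideal.span {(3 : GaussianInt)}) ^ n := by
  have h3 : ∀ b : GaussianInt, star ((3 : GaussianInt) ^ n * b) = (3 : GaussianInt) ^ n * star b := by
    intro b
    rw [star_mul', star_pow, show star (3 : GaussianInt) = 3 from by ext <;> simp]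
  rw [Ideal.span_singleton_pow, Ideal.mem_span_singleton, Ideal.mem_span_singleton]
  constructor
  · rintro ⟨b, hb⟩
    refine ⟨star b, ?_⟩
    rw [← h3, ← hb, star_star]
  · rintro ⟨b, hb⟩
    exact ⟨star b, by rw [hb, h3]⟩

/-- The `3`-adic valuation on `ℤ[i]` is `star`-invariant (same membership profile in the powers `(3)ⁿ`).
[folklore] -/
private theorem intValuation_star (a : GaussianInt) : threeSpec.intValuation (star a) = threeSpec.intValuation a := by
  by_cases ha : a = 0
  · rw [ha, star_zero]
  have hsa : star a ≠ 0 := fun h => ha (by rw [← star_star a, h, star_zero])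
  obtain ⟨c, hc⟩ : ∃ c : ℕ, threeSpec.intValuation a = WithZero.exp (-(c : ℤ)) :=
    ⟨_, threeSpec.intValuation_if_neg ha⟩
  obtain ⟨c', hc'⟩ : ∃ c : ℕ, threeSpec.intValuation (star a) = WithZero.exp (-(c : ℤ)) :=
    ⟨_, threeSpec.intValuation_if_neg hsa⟩
  have h1 : threeSpec.intValuation (star a) ≤ WithZero.exp (-(c : ℤ)) := by
    rw [HeightOneSpectrum.intValuation_le_pow_iff_mem]
    change star a ∈ Ideal.span {(3 : GaussianInt)} ^ c
    rw [star_mem_span_three_pow_iff, ← show threeSpec.asIdeal = Ideal.span {3} from rfl,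
      ← HeightOneSpectrum.intValuation_le_pow_iff_mem, hc]
  have h2 : threeSpec.intValuation a ≤ WithZero.exp (-(c' : ℤ)) := by
    rw [HeightOneSpectrum.intValuation_le_pow_iff_mem]
    change a ∈ Ideal.span {(3 : GaussianInt)} ^ c'
    rw [← star_mem_span_three_pow_iff, ← show threeSpec.asIdeal = Ideal.span {3} from rfl,
      ← HeightOneSpectrum.intValuation_le_pow_iff_mem, hc']
  rw [hc'] at h1 ⊢
  rw [hc] at h2 ⊢
  rw [WithZero.exp_le_exp] at h1 h2
  rw [WithZero.exp_inj]
  omega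

/-- The `3`-adic valuation of `ℚ(i)` is invariant under complex conjugation.
[cite: MochizukiEtTh2009, Def 3.3 p.73] -/
theorem val3_conj (z : GaussianRat) : val3 (conj z) = val3 z := by
  obtain ⟨x, y, hy, rfl⟩ := IsFractionRing.div_surjective (A := GaussianInt) z
  rw [map_div₀, conj_algebraMap, conj_algebraMap, map_div₀, map_div₀, val3,
    HeightOneSpectrum.valuation_of_algebraMap, HeightOneSpectrum.valuation_of_algebraMap,
    HeightOneSpectrum.valuation_of_algebraMap, HeightOneSpectrum.valuation_of_algebraMap,
    intValuation_star, intValuation_star]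

/-- **The `3`-adic valuation of `ℚ(i)` is invariant under every `ℚ`-algebra automorphism** (the `v_algEquiv` field
of the datum, for ALL of `Aut(L/K)`). [cite: MochizukiEtTh2009, Def 3.3 p.73] -/
theorem val3_algEquiv (σ : GaussianRat ≃ₐ[ℚ] GaussianRat) (z : GaussianRat) : val3 (σ z) = val3 z := by
  rcases algEquiv_eq_one_or_eq_conj σ with rfl | rfl
  · rfl
  · exact val3_conj z

/-- A unit of `ℤ[i]` is a fourth root of unity (`N(e) = 1` forces `e ∈ {±1, ±i}`). [folklore] -/
private theorem pow_four_eq_one_of_isUnit {e : GaussianInt} (he : IsUnit e) : e ^ 4 = 1 := by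
  have hn : e.norm = 1 := (Zsqrtd.norm_eq_one_iff' (by norm_num) e).mpr he
  rw [Zsqrtd.norm_def] at hn
  have hn' : e.re * e.re + e.im * e.im = 1 := by linarith
  have hre : e.re ^ 2 ≤ 1 := by nlinarith [mul_self_nonneg e.im]
  have him : e.im ^ 2 ≤ 1 := by nlinarith [mul_self_nonneg e.re]
  obtain ⟨h1, h2⟩ := abs_le.mp ((sq_le_one_iff_abs_le_one e.re).mp hre)
  obtain ⟨h3, h4⟩ := abs_le.mp ((sq_le_one_iff_abs_le_one e.im).mp him)
  have he4 : e ^ 4 = ⟨e.re, e.im⟩ ^ 4 := rfl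
  rw [he4]
  interval_cases hr : e.re <;> interval_cases hi : e.im <;> first
    | decide | (exfalso; simp at hn')

/-- In `ℤᵐ⁰`, a nonzero element admitting an `N`-th root for every `N ≥ 1` is `1`. [folklore] -/
private theorem WithZero.eq_one_of_forall_exists_pow_eq {x : WithZero (Multiplicative ℤ)} (hx : x ≠ 0)
    (h : ∀ N : ℕ+, ∃ y : WithZero (Multiplicative ℤ), y ^ (N : ℕ) = x) : x = 1 := by
  obtain ⟨y, hy⟩ := h ⟨(WithZero.log x).natAbs + 1, Nat.succ_pos _⟩
  have hy0 : y ≠ 0 := by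
    rintro rfl
    rw [zero_pow (PNat.ne_zero _)] at hy
    exact hx hy.symm
  set m := WithZero.log x with hm
  set k := WithZero.log y with hk
  have hlog : (((m.natAbs : ℕ) : ℤ) + 1) * k = m := by
    have h' := congrArg WithZero.log hy
    rw [WithZero.log_pow, PNat.mk_coe, nsmul_eq_mul, Nat.cast_add, Nat.cast_one] at h'
    exact h'
  rw [← WithZero.exp_log hx, WithZero.exp_eq_one]
  change m = 0
  -- `(|m| + 1) * k = m` forces `m = 0`
  have hn0 : (0 : ℤ) ≤ (m.natAbs : ℤ) := Int.natCast_nonneg _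
  rcases Int.natAbs_eq m with h1 | h1
  · rcases le_or_gt k 0 with hk0 | hk0
    · have : (((m.natAbs : ℕ) : ℤ) + 1) * k ≤ 0 := mul_nonpos_of_nonneg_of_nonpos (by linarith) hk0
      omega
    · have : (((m.natAbs : ℕ) : ℤ) + 1) * 1 ≤ (((m.natAbs : ℕ) : ℤ) + 1) * k :=
        mul_le_mul_of_nonneg_left (by omega) (by linarith)
      omega
  · rcases lt_or_ge k 0 with hk0 | hk0
    · have : (((m.natAbs : ℕ) : ℤ) + 1) * k ≤ (((m.natAbs : ℕ) : ℤ) + 1) * (-1) :=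
        mul_le_mul_of_nonneg_left (by omega) (by linarith)
      omega
    · have : 0 ≤ (((m.natAbs : ℕ) : ℤ) + 1) * k := mul_nonneg (by linarith) hk0
      omega

/-- Every adic valuation of an infinitely divisible unit of `ℚ(i)` is `1`. [folklore] -/
private theorem valuation_eq_one_of_divisible (w : HeightOneSpectrum GaussianInt) (c : GaussianRatˣ)
    (h : ∀ N : ℕ+, ∃ d : GaussianRatˣ, d ^ (N : ℕ) = c) : w.valuation GaussianRat (c : GaussianRat) = 1 := by
  refine WithZero.eq_one_of_forall_exists_pow_eq ((Valuation.ne_zero_iff _).mpr c.ne_zero) fun N => ?_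
  obtain ⟨d, hd⟩ := h N
  exact ⟨w.valuation GaussianRat (d : GaussianRat), by rw [← map_pow, ← Units.val_pow_eq_pow_val, hd]⟩

/-- An element of `ℚ(i)` all of whose adic valuations equal `1` is (the image of) a unit of `ℤ[i]` (it and its
inverse are integral at every height-one prime of the Dedekind domain `ℤ[i]`). [folklore] -/
private theorem exists_unit_eq_of_valuation_eq_one (z : GaussianRat) (hz : z ≠ 0)
    (h : ∀ w : HeightOneSpectrum GaussianInt, w.valuation GaussianRat z = 1) :
    ∃ e : GaussianInt, IsUnit e ∧ algebraMap GaussianInt GaussianRat e = z := by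
  obtain ⟨e, he⟩ := HeightOneSpectrum.mem_integers_of_valuation_le_one GaussianRat z (fun w => (h w).le)
  obtain ⟨e', he'⟩ := HeightOneSpectrum.mem_integers_of_valuation_le_one GaussianRat z⁻¹ (fun w => by
    rw [map_inv₀, h w, inv_one])
  refine ⟨e, IsUnit.of_mul_eq_one e' (IsFractionRing.injective GaussianInt GaussianRat ?_), he⟩
  rw [map_mul, map_one]
  change (algebraMap GaussianInt GaussianRat) e * (algebraMap GaussianInt GaussianRat) e' = 1
  rw [he, he', mul_inv_cancel₀ hz]

/-- **Prop. 3.2 (iii) for `ℚ(i)^×`**: a unit of `ℚ(i)` admitting an `N`-th root for every `N ≥ 1` is `1`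
(all its adic valuations are `1`, so it is a unit of `ℤ[i]`, a fourth root of unity; and it is a fourth power).
[cite: MochizukiEtTh2009, Prop 3.2 p.70] -/
theorem units_eq_one_of_forall_exists_pow_eq (c : GaussianRatˣ)
    (h : ∀ N : ℕ+, ∃ d : GaussianRatˣ, d ^ (N : ℕ) = c) : c = 1 := by
  obtain ⟨d, hd⟩ := h 4
  have hd4 : d ^ 4 = c := hd
  have hdval : ∀ w : HeightOneSpectrum GaussianInt, w.valuation GaussianRat (d : GaussianRat) = 1 := by
    intro w
    have hc := valuation_eq_one_of_divisible w c h
    rw [← hd4, Units.val_pow_eq_pow_val, map_pow] at hc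
    have hne : w.valuation GaussianRat (d : GaussianRat) ≠ 0 := (Valuation.ne_zero_iff _).mpr d.ne_zero
    rw [← WithZero.exp_log hne] at hc ⊢
    rw [← WithZero.exp_nsmul, WithZero.exp_eq_one, nsmul_eq_mul] at hc
    rw [WithZero.exp_eq_one]
    push_cast at hc
    omega
  obtain ⟨e, he, hed⟩ := exists_unit_eq_of_valuation_eq_one (d : GaussianRat) d.ne_zero hdval
  apply Units.ext
  rw [← hd4, Units.val_pow_eq_pow_val, ← hed, ← map_pow, pow_four_eq_one_of_isUnit he, map_one, Units.val_one]

end GaussianRat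

namespace LogDivisorModel.TateTowerArith

open GaussianRat

/-- **The arithmetic Tate tower over `ℚ(i)/ℚ` at the inert prime `3`** (class (b) NV inhabitant of
`TateTowerArith.Datum` with NON-trivial `Aut(L/K)`): `L = ℚ(i) = Frac ℤ[i]`, `K = ℚ`, `v` = the `3`-adic
valuation (`3` inert in `ℤ[i]`, so `v` is the unique valuation above `3`, Galois-invariant, and the rational
prime `3` is a uniformizer), Tate parameter `q = 3`, and Prop. 3.2 (iii) for `ℚ(i)^×` PROVED.
[cite: MochizukiEtTh2009, Def 3.1 p.70] -/
def Datum.gaussian : Datum ℚ GaussianRat where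
  v := val3
  finiteDimensional := GaussianRat.finiteDimensional
  v_algEquiv := val3_algEquiv
  q := 3
  v_q := by
    rw [map_ofNat]
    exact val3_three
  eq_one_of_divisible := units_eq_one_of_forall_exists_pow_eq

/-- `Datum ℚ ℚ(i)` is inhabited. [cite: MochizukiEtTh2009, Def 3.1 p.70] -/
theorem nonempty_datum_gaussian : Nonempty (Datum ℚ GaussianRat) := ⟨Datum.gaussian⟩

/-- **The constant-field Galois group of this datum is NON-trivial**: complex conjugation is a non-identity
element of `Aut(L/K) = Aut(ℚ(i)/ℚ)` (indeed `Aut(ℚ(i)/ℚ) = {1, conj}`,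
`GaussianRat.algEquiv_eq_one_or_eq_conj`).
[cite: MochizukiEtTh2009, Def 3.3 p.73] -/
theorem gaussian_aut_nontrivial : ∃ σ : GaussianRat ≃ₐ[ℚ] GaussianRat, σ ≠ 1 := ⟨conj, conj_ne_one⟩

/-- The Galois-correspondence law ([EtTh] Thm 3.7 (iii) binder) at the `ℚ(i)`-tower — non-vacuous with a
non-trivial constant-field Galois group. [cite: MochizukiEtTh2009, Thm 3.7 (iii) p.79] -/
theorem constGaloisLaw_gaussian : Datum.gaussian.action.ConstGaloisLaw := Datum.gaussian.constGaloisLaw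

/-- **The constant-field functor `D₀ → D^cnst` sees the non-trivial automorphism**: in the constant field of
`Z^log_∞` a point and its translate by `(0, conj)` have DIFFERENT classes.
[cite: MochizukiEtTh2009, Def 3.3 p.73] -/
theorem gaussian_constQuot_mk_ne (s : (Action.leftRegular (Grp ℚ GaussianRat)).V) :
    (Quotient.mk (Datum.gaussian.action.constOrbitSetoid (Action.leftRegular (Grp ℚ GaussianRat))) s :
        (Datum.gaussian.action.constQuotObj (Action.leftRegular (Grp ℚ GaussianRat))).V) ≠
      Quotient.mk _ ((Action.leftRegular (Grp ℚ GaussianRat)).ρ ((1 : Multiplicative ℤ), conj) s) := by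
  rw [Ne, Datum.gaussian.constQuot_leftRegular_mk_eq_iff]
  exact conj_ne_one

/-- The inertia of the constant-field action is exactly the chain translations `ℤ × 1`; in particular
`(0, conj)` is NOT inert. [cite: MochizukiEtTh2009, Def 3.3 p.73] -/
theorem gaussian_conj_not_mem_constInertia :
    ((1 : Multiplicative ℤ), conj) ∉ Datum.gaussian.action.constInertia := fun h =>
  conj_ne_one ((Datum.gaussian.mem_constInertia_iff _).1 h)

end LogDivisorModel.TateTowerArith

end Literature.AnabelianGeometry.EtaleTheta
end
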